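import Literature.NumberTheory.EllipticCurves.NonsplitNodeTateModule
import Literature.NumberTheory.GaloisRepresentations.QuadraticInertia
import Literature.NumberTheory.EllipticCurves.BSDConductorProofs
import Literature.NumberTheory.GaloisRepresentations.ArtinConductorProofs
import HarnessLib

/-!
# The Artin conductor of `V_ℓ(E_ns)` for a non-split node; the case `y² = x³ + 3x²` over `ℚ`

Topic `EllipticCurves`; sequel of `NonsplitNode` and `NonsplitNodeTateModule` (Silverman, *AEC*,
Prop. III.2.5 and Exercise 3.5: for the node `W_a : y² = x³ + a x²` the Galois module `E_ns(F̄)`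
is the torus `F̄ˣ` twisted by the quadratic character of `F(√a)`, so `V_ℓ(E_ns) ≅ ℚ_ℓ(1) ⊗ χ_a`).
Here the conductor exponents `a_v(V_ℓ(E_ns))`
(`Literature.NumberTheory.EllipticCurves.conductorExponentOf`, i.e. the Artin exponent
`⌊codim V^{I_𝔓} + Sw_𝔓⌋₊` of `ArtinConductor`) are computed far enough:

* over a number field `K`, `a ∈ 𝓞 K`, `2a ≠ 0`: `a_v = 0` at every `v ∤ 4aℓ`
  (`nodalCubic.conductorExponentOf_eq_zero`: `V_ℓ(E_ns)` is unramified there,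
  `nodalCubic.isUnramifiedAt_rationalTateGaloisRepOf`, and the tree's
  `GaloisRep.artinConductorExponent_eq_zero_of_isUnramifiedAt_holds`, Serre *Local Fields* VI §2
  Thm. 1'), and `a_v ≥ 1` at a place `v ∤ ℓ` above which some inertia element maps `√a` to `-√a`
  (`nodalCubic.one_le_conductorExponentOf`: it acts as `-1` on `V_ℓ ≅ ℚ_ℓ`, so `(V_ℓ)^{I_𝔓} = 0`,
  `codim = 1` and `a_v = ⌊1 + Sw⌋₊ ≥ 1` as `Sw ≥ 0`);
* over `ℚ` with `a = 3` (the non-split node `y² = x³ + 3x²`, tangent field `ℚ(√3)`): `a_v = 0`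
  away from `2, 3, ℓ` (`conductorExponentOf_three_eq_zero`), `a_3 ≥ 1` for `ℓ ≠ 3`
  (`one_le_conductorExponentOf_three`, inertia above `3` moves `√3`:
  `Literature.NumberTheory.GaloisRepresentations.exists_mem_inertia_smul_eq_neg_of_sq_eq_prime`),
  hence the prime-to-`ℓ` Artin conductor `𝔣^{(ℓ)}(V_ℓ(E_ns)) = conductorOf …` is a genuine
  finite product contained in `(3)`, in particular `≠ 1` (`conductorOf_three_ne_one`);
* the junk values on the curve side for a singular equation over any Dedekind domain (`Δ = 0`:
  `ord_v Δ_min = 0`, `f_v = 0`, `𝔣 = 1`, `N = 1`; primed names, the `𝓞 K` versions being in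
  `HasseWeilAbelianArtinConductor`).

These are the inputs of `BSDConductorNonsplitNodeProofs`, which refutes the conductor schemas of
`BSDConductor` / `HasseWeilAbelian` at `nodalCubic 3`.  Theorems only.

## References

* J. H. Silverman, *The Arithmetic of Elliptic Curves*, 2nd ed., GTM 106 (2009), Prop. III.2.5
  and Exercise 3.5. [SilvermanAEC2009]
* J.-P. Serre, *Local Fields*, GTM 67 (1979), Ch. VI §2 (Artin and Swan conductors).
  [SerreLocalFields1979]

## Design

`noncomputable section`, `open scoped Classical`; dot-notation extensions of `WeierstrassCurve`
(junk lemmas, primed) and theorems in `WeierstrassCurve.nodalCubic` (as in `NonsplitNode*`).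
Places of `𝓞 ℚ` are handled through `natCast_mem_asIdeal_iff_eq_primesEquiv_symm`
(`BSDConductorProofs`); hypotheses on a place are phrased as `2, 3, ℓ ∉ v` / `3 ∈ v`.
-/

noncomputable section

open scoped Classical NumberField AddSubgroup
open IsDedekindDomain Field Literature.NumberTheory.EllipticCurves
  Literature.NumberTheory.GaloisRepresentations

universe u

namespace WeierstrassCurve

/-! ### Junk values of the conductor of a singular equation over any Dedekind domain -/

section Singular

variable {A : Type*} [CommRing A] [IsDedekindDomain A] {K : Type*} [Field K] [Algebra A K]
  [IsFractionRing A K] (W : WeierstrassCurve K)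

/-- For a singular `W` (`Δ = 0`) every `ord_v (Δ_min)` is the junk value `0`, over any Dedekind
domain `A` with fraction field `K` (the integral local minimal model has `Δ = 0` too,
`addVal 0 = ⊤`, `⊤.toNat = 0`); the case `A = 𝓞 K` is
`WeierstrassCurve.ordMinimalDiscriminant_eq_zero_of_Δ_eq_zero` (`HasseWeilAbelianArtinConductor`),
same proof. [folklore] -/
theorem ordMinimalDiscriminant_eq_zero_of_Δ_eq_zero' (hW : W.Δ = 0) (v : HeightOneSpectrum A) :
    W.ordMinimalDiscriminant v = 0 := by
  have hX : (W.baseChange (v.adicCompletion K)).Δ = 0 := by rw [baseChange, map_Δ, hW, map_zero]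
  have hΔ : (((W.baseChange (v.adicCompletion K)).minimal
      (v.adicCompletionIntegers K)).integralModel (v.adicCompletionIntegers K)).Δ = 0 := by
    apply FaithfulSMul.algebraMap_injective (v.adicCompletionIntegers K) (v.adicCompletion K)
    rw [integralModel_Δ_eq, map_zero, minimal, variableChange_Δ, hX, mul_zero]
  change (IsDiscreteValuationRing.addVal _ ((((W.baseChange (v.adicCompletion K)).minimal
    (v.adicCompletionIntegers K)).integralModel (v.adicCompletionIntegers K)).Δ)).toNat = 0
  rw [hΔ, IsDiscreteValuationRing.addVal_zero, ENat.toNat_top]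

/-- For a singular `W` every conductor exponent `f_v = ord_v (Δ_min) + 1 - m_v` is the junk
value `0`, over any Dedekind domain (case `𝓞 K`:
`WeierstrassCurve.conductorExponent_eq_zero_of_Δ_eq_zero`). [folklore] -/
theorem conductorExponent_eq_zero_of_Δ_eq_zero' (hW : W.Δ = 0) (v : HeightOneSpectrum A) :
    W.conductorExponent v = 0 := by
  have h0 := W.ordMinimalDiscriminant_eq_zero_of_Δ_eq_zero' hW v
  have := (W.kodairaSymbolAt v).numComponents_pos
  unfold conductorExponent numComponentsAt
  omega

/-- For a singular `W` the conductor ideal `∏ᶠ_v v ^ {f_v}` is the junk value `1`, over any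
Dedekind domain (case `𝓞 K`: `WeierstrassCurve.conductor_ringOfIntegers_eq_one_of_Δ_eq_zero`).
[folklore] -/
theorem conductor_eq_one_of_Δ_eq_zero' (A : Type*) [CommRing A] [IsDedekindDomain A]
    [Algebra A K] [IsFractionRing A K] (hW : W.Δ = 0) : W.conductor A = 1 := by
  unfold WeierstrassCurve.conductor
  exact finprod_eq_one_of_forall_eq_one fun v ↦ by
    rw [W.conductorExponent_eq_zero_of_Δ_eq_zero' hW v, pow_zero]

/-- For a singular `W` the numerical conductor `N(𝔣)` is the junk value `1`. [folklore] -/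
theorem conductorNorm_eq_one_of_Δ_eq_zero' (A : Type*) [CommRing A] [IsDedekindDomain A]
    [Algebra A K] [IsFractionRing A K] [Module.Free ℤ A] (hW : W.Δ = 0) :
    W.conductorNorm A = 1 := by
  unfold conductorNorm
  rw [W.conductor_eq_one_of_Δ_eq_zero' A hW, Ideal.one_eq_top, Ideal.absNorm_top]

end Singular

namespace nodalCubic

/-! ### The conductor exponents of `V_ℓ(E_ns)` over a number field -/

section NumberField

variable {K : Type u} [Field K] [NumberField K] {a : K} {b : 𝓞 K}
  (hb : algebraMap (𝓞 K) K b = a) (ℓ : ℕ) [Fact ℓ.Prime]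
include hb

/-- **`V_ℓ(E_ns)` is unramified at `v ∤ 4aℓ`** (`GaloisRep.IsUnramifiedAt`: every inertia group
above `v` acts trivially), for the node `y² = x³ + a x²`, `a ∈ 𝓞 K`, `2a ≠ 0`.
Silverman, *AEC*, Exercise 3.5; Serre, *Abelian ℓ-adic representations*, I §1.2, §2.1.
[cite: SilvermanAEC2009, Exercise 3.5] -/
theorem isUnramifiedAt_rationalTateGaloisRepOf (ha : 2 * a ≠ 0)
    (h : Continuous fun x : absoluteGaloisGroup K × RationalTateModule (geomPoints (nodalCubic a)) ℓ ↦
      rationalTateRepresentation (absoluteGaloisGroup K) (geomPoints (nodalCubic a)) ℓ x.1 x.2)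
    {v : HeightOneSpectrum (𝓞 K)} (hv : 4 * b ∉ v.asIdeal) (hvℓ : (ℓ : 𝓞 K) ∉ v.asIdeal) :
    (rationalTateGaloisRepOf (geomPoints (nodalCubic a)) ℓ h).IsUnramifiedAt v :=
  fun _ h𝔓 _ hσ ↦ rationalTateRepresentation_eq_one_of_mem_inertia hb ℓ ha hv hvℓ h𝔓 hσ

/-- **`a_v(V_ℓ(E_ns)) = 0` at `v ∤ 4aℓ`**: the conductor exponent
(`Literature.NumberTheory.EllipticCurves.conductorExponentOf`, i.e. `GaloisRep.artinConductorExponent`)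
of the rational Tate module of the node vanishes at every place `v` with `4a ∉ v`, `ℓ ∉ v`
(unramified there; `GaloisRep.artinConductorExponent_eq_zero_of_isUnramifiedAt_holds`, Serre,
*Local Fields*, VI §2 Thm. 1'). [cite: SilvermanAEC2009, Exercise 3.5] -/
theorem conductorExponentOf_eq_zero (ha : 2 * a ≠ 0)
    (h : Continuous fun x : absoluteGaloisGroup K × RationalTateModule (geomPoints (nodalCubic a)) ℓ ↦
      rationalTateRepresentation (absoluteGaloisGroup K) (geomPoints (nodalCubic a)) ℓ x.1 x.2)
    {v : HeightOneSpectrum (𝓞 K)} (hv : 4 * b ∉ v.asIdeal) (hvℓ : (ℓ : 𝓞 K) ∉ v.asIdeal) :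
    conductorExponentOf (geomPoints (nodalCubic a)) ℓ h v = 0 :=
  GaloisRep.artinConductorExponent_eq_zero_of_isUnramifiedAt_holds
    (isUnramifiedAt_rationalTateGaloisRepOf hb ℓ ha h hv hvℓ)

omit hb in
/-- **`a_v(V_ℓ(E_ns)) ≥ 1` at a place where inertia moves `√a`.**  For the node `y² = x³ + a x²`
(`2a ≠ 0`), a prime `ℓ ≠ char`, a place `v ∤ ℓ` such that above every prime `𝔓 ∣ v` of `\bar ℤ_K`
some inertia element maps `√a` to `-√a` (the places ramified in `K(√a)`): such an element acts as
`-1` on `V_ℓ(E_ns) ≅ ℚ_ℓ` (`rationalTateRepresentation_eq_neg_one_of_mem_inertia`,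
`finrank_rationalTateModule_eq_one`), so `(V_ℓ)^{I_𝔓} = 0`, `codim = 1` and
`a_v = ⌊1 + Sw⌋₊ ≥ 1` (`Sw ≥ 0`).  Silverman, *AEC*, Exercise 3.5; Serre, *Local Fields*, VI §2.
[cite: SilvermanAEC2009, Exercise 3.5] -/
theorem one_le_conductorExponentOf (ha : 2 * a ≠ 0) (hℓK : (ℓ : K) ≠ 0)
    (h : Continuous fun x : absoluteGaloisGroup K × RationalTateModule (geomPoints (nodalCubic a)) ℓ ↦
      rationalTateRepresentation (absoluteGaloisGroup K) (geomPoints (nodalCubic a)) ℓ x.1 x.2)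
    {v : HeightOneSpectrum (𝓞 K)} (hvℓ : (ℓ : 𝓞 K) ∉ v.asIdeal)
    (hram : ∀ 𝔓 ∈ v.primesAbove, ∃ σ ∈ 𝔓.inertia (absoluteGaloisGroup K), σ • sqrt a = -sqrt a) :
    1 ≤ conductorExponentOf (geomPoints (nodalCubic a)) ℓ h v := by
  set ρ := rationalTateGaloisRepOf (geomPoints (nodalCubic a)) ℓ h with hρ
  haveI : Module.Finite ℚ_[ℓ] (RationalTateModule (geomPoints (nodalCubic a)) ℓ) :=
    module_finite_rationalTateModule ℓ ha
  set 𝔓 := (HeightOneSpectrum.primesAbove_nonempty v).some with h𝔓_def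
  have h𝔓 : 𝔓 ∈ v.primesAbove := (HeightOneSpectrum.primesAbove_nonempty v).some_mem
  obtain ⟨σ, hσ, hσa⟩ := hram 𝔓 h𝔓
  have hneg : ρ σ = -1 :=
    rationalTateRepresentation_eq_neg_one_of_mem_inertia ℓ ha hvℓ h𝔓 hσ hσa
  -- the inertia group has no non-zero fixed vector
  have hbot : ρ.fixedSubmodule (𝔓.inertia (absoluteGaloisGroup K)) = ⊥ := by
    rw [eq_bot_iff]
    intro w hw
    rw [ContinuousRep.mem_fixedSubmodule] at hw
    have h1 := hw σ hσ
    rw [hneg, LinearMap.neg_apply, Module.End.one_apply] at h1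
    rw [Submodule.mem_bot]
    have h2 : (2 : ℚ_[ℓ]) • w = 0 := by
      rw [two_smul]
      nth_rewrite 1 [← h1]
      exact neg_add_cancel w
    exact (smul_eq_zero.mp h2).resolve_left two_ne_zero
  have hcodim : ρ.codimFixed (𝔓.inertia (absoluteGaloisGroup K)) = 1 := by
    rw [ContinuousRep.codimFixed_eq_finrank_sub, hbot, finrank_bot, Nat.sub_zero,
      finrank_rationalTateModule_eq_one ℓ ha hℓK]
  -- `a_v = ⌊codim + Sw⌋₊ ≥ 1`
  change 1 ≤ GaloisRep.artinConductorExponent v ρ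
  unfold GaloisRep.artinConductorExponent
  apply Nat.le_floor
  rw [← h𝔓_def, GaloisRep.artinConductorAt_def, hcodim, Nat.cast_one]
  linarith [ρ.swanConductorAt_nonneg (R := 𝓞 K) 𝔓]

end NumberField

/-! ### The non-split node `y² = x³ + 3x²` over `ℚ` -/

section Rat

variable (ℓ : ℕ) [Fact ℓ.Prime]

/-- `2 · 3 ≠ 0` in `ℚ`: `y² = x³ + 3x²` is a node. [folklore] -/
theorem two_mul_three_ne_zero : (2 : ℚ) * 3 ≠ 0 := by norm_num

/-- `(3 : 𝓞 ℚ) ↦ (3 : ℚ)`. [folklore] -/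
theorem algebraMap_three : algebraMap (𝓞 ℚ) ℚ 3 = 3 := map_ofNat _ 3

/-- A finite place of `𝓞 ℚ` away from `2` and `3` does not contain `12 = 4 · 3`. [folklore] -/
theorem four_mul_three_not_mem {v : HeightOneSpectrum (𝓞 ℚ)} (h2 : (2 : 𝓞 ℚ) ∉ v.asIdeal)
    (h3 : (3 : 𝓞 ℚ) ∉ v.asIdeal) : 4 * (3 : 𝓞 ℚ) ∉ v.asIdeal := by
  intro h
  rw [show (4 : 𝓞 ℚ) * 3 = 2 * (2 * 3) by norm_num] at h
  rcases v.isPrime.mem_or_mem h with h' | h'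
  · exact h2 h'
  · rcases v.isPrime.mem_or_mem h' with h'' | h''
    · exact h2 h''
    · exact h3 h''

/-- **`a_v(V_ℓ(E_ns)) = 0` away from `2, 3, ℓ`** for the node `y² = x³ + 3x²` over `ℚ`.
[cite: SilvermanAEC2009, Exercise 3.5] -/
theorem conductorExponentOf_three_eq_zero
    (h : Continuous fun x : absoluteGaloisGroup ℚ × RationalTateModule (geomPoints (nodalCubic (3 : ℚ))) ℓ ↦
      rationalTateRepresentation (absoluteGaloisGroup ℚ) (geomPoints (nodalCubic (3 : ℚ))) ℓ x.1 x.2)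
    {v : HeightOneSpectrum (𝓞 ℚ)} (h2 : (2 : 𝓞 ℚ) ∉ v.asIdeal) (h3 : (3 : 𝓞 ℚ) ∉ v.asIdeal)
    (hℓ : (ℓ : 𝓞 ℚ) ∉ v.asIdeal) :
    conductorExponentOf (geomPoints (nodalCubic (3 : ℚ))) ℓ h v = 0 :=
  conductorExponentOf_eq_zero algebraMap_three ℓ two_mul_three_ne_zero h
    (four_mul_three_not_mem h2 h3) hℓ

/-- The place of `𝓞 ℚ` above `3`. [folklore] -/
theorem natCast_three_mem_iff (v : HeightOneSpectrum (𝓞 ℚ)) :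
    (3 : 𝓞 ℚ) ∈ v.asIdeal ↔ v = (Rat.HeightOneSpectrum.primesEquiv (R := 𝓞 ℚ)).symm ⟨3, Nat.prime_three⟩ := by
  rw [← natCast_mem_asIdeal_iff_eq_primesEquiv_symm v Nat.prime_three, Nat.cast_ofNat]

/-- For a prime `ℓ ≠ 3`, the place above `3` does not contain `ℓ`. [folklore] -/
theorem natCast_not_mem_of_three_mem (hℓ3 : ℓ ≠ 3) {v : HeightOneSpectrum (𝓞 ℚ)}
    (h3 : (3 : 𝓞 ℚ) ∈ v.asIdeal) : (ℓ : 𝓞 ℚ) ∉ v.asIdeal := by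
  intro hℓ
  have hprime : ℓ.Prime := Fact.out
  have e1 := (natCast_three_mem_iff v).mp h3
  have e2 := (natCast_mem_asIdeal_iff_eq_primesEquiv_symm v hprime).mp hℓ
  rw [e1] at e2
  have := congrArg Subtype.val ((Rat.HeightOneSpectrum.primesEquiv (R := 𝓞 ℚ)).symm.injective e2)
  exact hℓ3 (by simpa using this.symm)

/-- **`a_3(V_ℓ(E_ns)) ≥ 1`** for the non-split node `y² = x³ + 3x²` over `ℚ` and a prime `ℓ ≠ 3`:
above `3` there are inertia elements mapping `√3` to `-√3`
(`exists_mem_inertia_smul_eq_neg_of_sq_eq_prime`: `3` ramifies in `ℚ(√3)`), and they act as `-1`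
on `V_ℓ(E_ns) ≅ ℚ_ℓ`. [cite: SilvermanAEC2009, Exercise 3.5] -/
theorem one_le_conductorExponentOf_three (hℓ3 : ℓ ≠ 3)
    (h : Continuous fun x : absoluteGaloisGroup ℚ × RationalTateModule (geomPoints (nodalCubic (3 : ℚ))) ℓ ↦
      rationalTateRepresentation (absoluteGaloisGroup ℚ) (geomPoints (nodalCubic (3 : ℚ))) ℓ x.1 x.2)
    {v : HeightOneSpectrum (𝓞 ℚ)} (h3 : (3 : 𝓞 ℚ) ∈ v.asIdeal) :
    1 ≤ conductorExponentOf (geomPoints (nodalCubic (3 : ℚ))) ℓ h v := by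
  have hprime : ℓ.Prime := Fact.out
  refine one_le_conductorExponentOf ℓ two_mul_three_ne_zero (by exact_mod_cast hprime.ne_zero) h
    (natCast_not_mem_of_three_mem ℓ hℓ3 h3) fun 𝔓 h𝔓 ↦ ?_
  have hs : sqrt (3 : ℚ) ^ 2 = ((3 : ℕ) : AlgebraicClosure ℚ) := by
    rw [sqrt_sq, map_ofNat, Nat.cast_ofNat]
  have h3' : ((3 : ℕ) : 𝓞 ℚ) ∈ v.asIdeal := by rwa [Nat.cast_ofNat]
  exact exists_mem_inertia_smul_eq_neg_of_sq_eq_prime Nat.prime_three hs h3' h𝔓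

/-- **The prime-to-`ℓ` Artin conductor of `V_ℓ(E_ns)` is non-trivial** for the non-split node
`y² = x³ + 3x²` over `ℚ` and every prime `ℓ ≠ 3`: `𝔣^{(ℓ)}(V_ℓ(E_ns)) ⊆ (3) ≠ (1)`.  The
exponents vanish outside `{2, 3, ℓ}` (`conductorExponentOf_three_eq_zero`), so the `finprod`
defining `conductorOf` is a genuine finite product, divisible by its factor `(3)^{a_3}` with
`a_3 ≥ 1` (`one_le_conductorExponentOf_three`).  This is the Galois side of the counterexample
to the singular clause of the conductor schemas (`BSDConductorSingularProofs`): informally,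
`V_ℓ(E_ns) ≅ ℚ_ℓ(1) ⊗ χ₁₂` has conductor divisible by `3`. [cite: SilvermanAEC2009, Exercise 3.5] -/
theorem conductorOf_three_ne_one (hℓ3 : ℓ ≠ 3)
    (h : Continuous fun x : absoluteGaloisGroup ℚ × RationalTateModule (geomPoints (nodalCubic (3 : ℚ))) ℓ ↦
      rationalTateRepresentation (absoluteGaloisGroup ℚ) (geomPoints (nodalCubic (3 : ℚ))) ℓ x.1 x.2) :
    conductorOf (geomPoints (nodalCubic (3 : ℚ))) ℓ h ≠ 1 := by
  have hprime : ℓ.Prime := Fact.out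
  set v₂ : HeightOneSpectrum (𝓞 ℚ) :=
    (Rat.HeightOneSpectrum.primesEquiv (R := 𝓞 ℚ)).symm ⟨2, Nat.prime_two⟩ with hv₂
  set v₃ : HeightOneSpectrum (𝓞 ℚ) :=
    (Rat.HeightOneSpectrum.primesEquiv (R := 𝓞 ℚ)).symm ⟨3, Nat.prime_three⟩ with hv₃
  set f : HeightOneSpectrum (𝓞 ℚ) → Ideal (𝓞 ℚ) := fun v ↦
    if (ℓ : 𝓞 ℚ) ∈ v.asIdeal then 1 else
      v.asIdeal ^ conductorExponentOf (geomPoints (nodalCubic (3 : ℚ))) ℓ h v with hf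
  have hconductor : conductorOf (geomPoints (nodalCubic (3 : ℚ))) ℓ h = ∏ᶠ v, f v := rfl
  -- the support of `f` is contained in `{v₂, v₃}`
  have hsupp : Function.mulSupport f ⊆ {v₂, v₃} := by
    intro v hv
    rw [Function.mem_mulSupport] at hv
    by_contra hv'
    simp only [Set.mem_insert_iff, Set.mem_singleton_iff, not_or] at hv'
    apply hv
    simp only [hf]
    split_ifs with hℓv
    · rfl
    · have h2 : (2 : 𝓞 ℚ) ∉ v.asIdeal := fun h2 ↦ hv'.1 <| by
        rw [← natCast_mem_asIdeal_iff_eq_primesEquiv_symm v Nat.prime_two, Nat.cast_ofNat]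
        exact h2
      have h3 : (3 : 𝓞 ℚ) ∉ v.asIdeal := fun h3 ↦ hv'.2 ((natCast_three_mem_iff v).mp h3)
      rw [conductorExponentOf_three_eq_zero ℓ h h2 h3 hℓv, pow_zero]
  have hfin : (Function.mulSupport f).Finite := (Set.toFinite {v₂, v₃}).subset hsupp
  -- the factor at `v₃` divides the product and is a positive power of `v₃`
  have h3mem : (3 : 𝓞 ℚ) ∈ v₃.asIdeal := (natCast_three_mem_iff v₃).mpr rfl
  have hℓv₃ : (ℓ : 𝓞 ℚ) ∉ v₃.asIdeal := natCast_not_mem_of_three_mem ℓ hℓ3 h3mem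
  have hf3 : f v₃ = v₃.asIdeal ^ conductorExponentOf (geomPoints (nodalCubic (3 : ℚ))) ℓ h v₃ := by
    simp only [hf, if_neg hℓv₃]
  have hdvd : f v₃ ∣ ∏ᶠ v, f v := finprod_mem_dvd v₃ hfin
  have hle : conductorOf (geomPoints (nodalCubic (3 : ℚ))) ℓ h ≤ v₃.asIdeal := by
    rw [hconductor]
    refine (Ideal.le_of_dvd hdvd).trans ?_
    rw [hf3]
    exact Ideal.pow_le_self (Nat.one_le_iff_ne_zero.mp
      (one_le_conductorExponentOf_three ℓ hℓ3 h h3mem))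
  intro h1
  rw [h1, Ideal.one_eq_top, top_le_iff] at hle
  exact v₃.isPrime.ne_top hle

end Rat

end nodalCubic

end WeierstrassCurve

end
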